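import Summits.BirchSwinnertonDyer.Rank1Residual.Additive.QuadraticTwistTypeG
import Literature.NumberTheory.EllipticCurves.Rank1Residual.Predicates
import Literature.NumberTheory.EllipticCurves.TateModuleTwistTransportProofs
import HarnessLib

/-!
# Additive classes X3/X4, defect 2: hypothesis (im) is the same for `E` and its twist `E^{(p*)}`

HONEST FRAMING (cell `b2b-bsdres`, run/shared/lean/b2b/bsd-rank1-residual/, verbatim in every
file): the goal of the cell is to DELETE the COMBINATION-SHAPED residual classes of the
Birch–Swinnerton-Dyer formula for ALL analytic-rank `≤ 1` elliptic curves over `ℚ` — "full BSD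
formula for every rank `≤ 1` curve in class `C`" assembled STRICTLY from published theorems — so
that the rank-`≤ 1` remainder becomes exactly the CONSTRUCTION-SHAPED classes, which are TYPED
(missing-input `Prop`s), NOT attempted. This is not "finishing BSD". Sub-cell `additive-p2`
(X3/X4 at an additive prime, potentially good ORDINARY half; CLASS-OWNERS row "X3/X4 additive —
pot. good ordinary / X3♯(G-ord)"): research route; no claim beyond the stated classes; nothing here
is a class theorem and no named fact is introduced (theorems only).

## What this module proves (our own bookkeeping, hence `Summits/`)

The base-change-and-descend route for the semistability-defect-2 case (Kodaira `I₀*`) replaces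
`(E, p)` by the GOOD ORDINARY twist pair `(E^{(p*)}, p)`, `p* = (−1)^{(p−1)/2} p` (sibling files
`QuadraticTwistTypeG[Ord].lean`; descent consumer `GordDescent.lean`). The published theorem that
covers a good ordinary irreducible pair at `p > 3` (Burungale–Castella–Skinner, IMRN 2025,
Cor. 1.3.1; partition row C2) carries hypothesis **(im)**: "there exists `σ ∈ G_{ℚ(μ_{p^∞})}` such
that `T/(σ − 1)T ≃ ℤ_p`" (tree predicate `Rank1Residual.BigIm`, stated on the integral Tate module
`W.tateModule p`). This file proves that (im) for `E^{(p*)}` is (im) for `E`: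

* `map_comp_galoisRepTate_sub_id`, `nonempty_quotient_equiv_of_addEquiv`, `bigIm_of_addEquiv` —
  functoriality: an additive isomorphism `f : E₁(ℚ̄) ≃+ E₂(ℚ̄)` commuting with `σ` induces
  `T_pE₁ ≃ T_pE₂` intertwining `ρ(σ)`, hence `T_pE₁/(σ−1) ≃ T_pE₂/(σ−1)`;
* `bigIm_smul_iff` — (im) is a property of the curve, not of the Weierstrass model
  (`VariableChange.pointEquivBaseChange` is `Γ_ℚ`-equivariant);
* `smul_geomSqrt_pStar` — **`√p* ∈ ℚ(ζ_p)`**: every `σ ∈ Γ_ℚ` fixing the `p`-power roots of unity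
  fixes `√p*` (quadratic Gauss sum, `exists_sq_eq_pStar`; `ℚ(ζ_p) = ℚ[ζ_p]`, power basis);
* `bigIm_quadraticTwist_pStar_iff` — **`BigIm E^{(p*)} p ↔ BigIm E p`** (`p` odd): the twisting
  isomorphism `E^{(d)}(ℚ̄) ≃+ E(ℚ̄)` is equivariant for `Γ_{ℚ(√d)}` (tree
  `exists_addEquiv_geomPoints_quadraticTwist`, Silverman *AEC* X.5.4), and
  `G_{ℚ(μ_{p^∞})} ≤ Γ_{ℚ(√p*)}`; `bigIm_iff_of_model_twist_pStar` — the same for any `ℚ`-model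
  `Wd = C • E^{(p*)}` (e.g. a globally minimal one).

So in the X4♯(G-ord, e = 2) class theorem the hypothesis (im) may be placed on `E` itself (where
for `p ≥ 5` it follows from surj(p), x9's `X9.bigIm_of_surj`), not on the twist.

References: A. Burungale, F. Castella, C. Skinner, IMRN 2025 rnaf082 = arXiv:2405.00270v2, p. 2,
hypothesis (im); J. H. Silverman, *AEC* III.§7 (Tate module, functoriality), X.2 Prop. 2.4, X.5
Cor. 5.4 (twists); K. Ireland, M. Rosen, *A Classical Introduction to Modern Number Theory*,
Prop. 6.3.2 (`g² = (−1)^{(p−1)/2} p`); J.-P. Serre, *Abelian ℓ-adic representations* (1968) I.1.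
-/

noncomputable section

open scoped Classical

open WeierstrassCurve Field Literature.NumberTheory.EllipticCurves
  Literature.NumberTheory.EllipticCurves.Rank1Residual

namespace Summit.BirchSwinnertonDyer.Rank1Residual.Additive

/-! ### Transport of the (im) witness along an equivariant isomorphism of geometric points -/

section Transport

variable {V₁ V₂ : WeierstrassCurve ℚ} (p : ℕ) [Fact p.Prime]

/-- If `f : E₁(ℚ̄) ≃+ E₂(ℚ̄)` commutes with `σ ∈ Γ_ℚ`, then `T_p f` (the tree's `TateModule.map`)
intertwines `ρ_{E₁,p}(σ) − 1` and `ρ_{E₂,p}(σ) − 1` (componentwise: `f(σ a_n) = σ f(a_n)`).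
Silverman, *AEC* III.§7. -/
theorem map_comp_galoisRepTate_sub_id (f : V₁.geomPoints ≃+ V₂.geomPoints)
    (σ : absoluteGaloisGroup ℚ) (hf : ∀ P, f (σ • P) = σ • f P) :
    TateModule.map p f.toAddMonoidHom ∘ₗ (V₁.galoisRepTate p σ - LinearMap.id) =
      (V₂.galoisRepTate p σ - LinearMap.id) ∘ₗ TateModule.map p f.toAddMonoidHom := by
  refine LinearMap.ext fun a ↦ TateModule.ext fun n ↦ ?_
  simp [hf]

/-- **Transport of the rank-one-cokernel witness.** If `f : E₁(ℚ̄) ≃+ E₂(ℚ̄)` commutes with `σ`,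
then `T_p f` carries `(σ − 1)T_pE₁` onto `(σ − 1)T_pE₂`, so `T_pE₁/(σ−1)T_pE₁ ≃ ℤ_p` implies
`T_pE₂/(σ−1)T_pE₂ ≃ ℤ_p` (Mathlib `Submodule.Quotient.equiv`). -/
theorem nonempty_quotient_equiv_of_addEquiv (f : V₁.geomPoints ≃+ V₂.geomPoints)
    (σ : absoluteGaloisGroup ℚ) (hf : ∀ P, f (σ • P) = σ • f P)
    (h : Nonempty ((V₁.tateModule p ⧸ LinearMap.range (V₁.galoisRepTate p σ - LinearMap.id))
      ≃ₗ[ℤ_[p]] ℤ_[p])) :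
    Nonempty ((V₂.tateModule p ⧸ LinearMap.range (V₂.galoisRepTate p σ - LinearMap.id))
      ≃ₗ[ℤ_[p]] ℤ_[p]) := by
  obtain ⟨e⟩ := h
  -- `T_p f` is an isomorphism with inverse `T_p f⁻¹` (functoriality: `map_comp`, `map_id`)
  let Φ : V₁.tateModule p ≃ₗ[ℤ_[p]] V₂.tateModule p :=
    LinearEquiv.ofLinear (TateModule.map p f.toAddMonoidHom) (TateModule.map p f.symm.toAddMonoidHom)
      (by
        rw [← TateModule.map_comp]
        convert TateModule.map_id (A := V₂.geomPoints) (p := p) using 2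
        ext x; simp)
      (by
        rw [← TateModule.map_comp]
        convert TateModule.map_id (A := V₁.geomPoints) (p := p) using 2
        ext x; simp)
  have hΦ : (Φ : V₁.tateModule p →ₗ[ℤ_[p]] V₂.tateModule p) = TateModule.map p f.toAddMonoidHom :=
    rfl
  have hrange : (LinearMap.range (V₁.galoisRepTate p σ - LinearMap.id)).map
      (Φ : V₁.tateModule p →ₗ[ℤ_[p]] V₂.tateModule p) =
      LinearMap.range (V₂.galoisRepTate p σ - LinearMap.id) := by
    rw [← LinearMap.range_comp, hΦ, map_comp_galoisRepTate_sub_id p f σ hf, LinearMap.range_comp,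
      ← hΦ, LinearEquiv.range, Submodule.map_top]
  exact ⟨(Submodule.Quotient.equiv _ _ Φ hrange).symm.trans e⟩

/-- **(im) along an isomorphism of Galois modules**: if `f : E₁(ℚ̄) ≃+ E₂(ℚ̄)` commutes with every
`σ ∈ Γ_ℚ` fixing the `p`-power roots of unity (`σ ∈ G_{ℚ(μ_{p^∞})}`), then `BigIm E₁ p → BigIm E₂ p`
(the same `σ` is a witness). [cite: BurungaleCastellaSkinner2025, p. 2, hypothesis (im)] -/
theorem bigIm_of_addEquiv (f : V₁.geomPoints ≃+ V₂.geomPoints)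
    (hf : ∀ σ : absoluteGaloisGroup ℚ,
      (∀ ζ : AlgebraicClosure ℚ, ∀ n : ℕ, ζ ^ p ^ n = 1 → absoluteGaloisGroup.toAlgEquiv ℚ σ ζ = ζ) →
      ∀ P, f (σ • P) = σ • f P)
    (h : BigIm V₁ p) : BigIm V₂ p := by
  obtain ⟨σ, hσ, hq⟩ := h
  exact ⟨σ, hσ, nonempty_quotient_equiv_of_addEquiv p f σ (hf σ hσ) hq⟩

/-- **(im) is a property of the curve, not of the Weierstrass model**: `BigIm (C • V) p ↔ BigIm V p`
for every change of variables `C` over `ℚ` (the substitution `V(ℚ̄) ≃+ (C • V)(ℚ̄)`,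
`VariableChange.pointEquivBaseChange`, commutes with `Γ_ℚ`: `pointEquivBaseChange_map_algEquiv`).
Silverman, *AEC* III.3.1(b), VIII.§1. -/
theorem bigIm_smul_iff (V : WeierstrassCurve ℚ) (C : VariableChange ℚ) :
    BigIm (C • V) p ↔ BigIm V p := by
  set f : V.geomPoints ≃+ (C • V).geomPoints :=
    VariableChange.pointEquivBaseChange V C (AlgebraicClosure ℚ) with hf
  have hfσ : ∀ σ : absoluteGaloisGroup ℚ, ∀ P, f (σ • P) = σ • f P := by
    intro σ P
    exact VariableChange.pointEquivBaseChange_map_algEquiv V C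
      (absoluteGaloisGroup.toAlgEquiv ℚ σ) P
  constructor
  · intro h
    refine bigIm_of_addEquiv p f.symm (fun σ _ P ↦ ?_) h
    apply f.injective
    rw [AddEquiv.apply_symm_apply, hfσ, AddEquiv.apply_symm_apply]
  · intro h
    exact bigIm_of_addEquiv p f (fun σ _ P ↦ hfσ σ P) h

end Transport

/-! ### `√p* ∈ ℚ(μ_p)`: it is fixed by `G_{ℚ(μ_{p^∞})}` -/

/-- **`√p*` lies in `ℚ(ζ_p)`, so it is fixed by `G_{ℚ(μ_{p^∞})}`**: for `p` odd and `σ ∈ Γ_ℚ`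
fixing every `p`-power root of unity of `ℚ̄`, `σ(√p*) = √p*`, where `√p* = geomSqrt p*` is the
tree's chosen square root in `ℚ̄` and `p* = (−1)^{⌊p/2⌋} p`. Proof: `p* = g²` for a quadratic Gauss
sum `g ∈ ℚ(ζ_p)` (`exists_sq_eq_pStar`, Ireland–Rosen Prop. 6.3.2); an embedding
`φ : ℚ(ζ_p) → ℚ̄` satisfies `σ ∘ φ = φ` because both agree on the power-basis generator `ζ_p`
(`IsPrimitiveRoot.powerBasis`, `PowerBasis.algHom_ext`) — `σ` fixes `φ(ζ_p)`, a `p`-th root of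
unity; and `geomSqrt p* = ±φ(g)`. -/
theorem smul_geomSqrt_pStar (p : ℕ) [hp : Fact p.Prime] (hp2 : p ≠ 2) (σ : absoluteGaloisGroup ℚ)
    (hσ : ∀ ζ : AlgebraicClosure ℚ, ∀ n : ℕ, ζ ^ p ^ n = 1 →
      absoluteGaloisGroup.toAlgEquiv ℚ σ ζ = ζ) :
    σ • geomSqrt ((-1 : ℚ) ^ (p / 2) * p) = geomSqrt ((-1 : ℚ) ^ (p / 2) * p) := by
  haveI hcyc : IsCyclotomicExtension {p} ℚ (CyclotomicField p ℚ) := by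
    have h : (CyclotomicField.algebra p ℚ : Algebra ℚ (CyclotomicField p ℚ)) =
        DivisionRing.toRatAlgebra :=
      Subsingleton.elim _ _
    exact h ▸ CyclotomicField.isCyclotomicExtension p ℚ
  haveI : NeZero p := ⟨hp.out.ne_zero⟩
  obtain ⟨g, hg⟩ := exists_sq_eq_pStar p (CyclotomicField p ℚ) hp2
  have hζ := IsCyclotomicExtension.zeta_spec p ℚ (CyclotomicField p ℚ)
  -- an embedding `ℚ(ζ_p) → ℚ̄` and the automorphism `σ` as a ring map
  let φ : CyclotomicField p ℚ →ₐ[ℚ] AlgebraicClosure ℚ := IsAlgClosed.lift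
  let τ : AlgebraicClosure ℚ →+* AlgebraicClosure ℚ :=
    (absoluteGaloisGroup.toAlgEquiv ℚ σ : AlgebraicClosure ℚ →+* AlgebraicClosure ℚ)
  have hτ : ∀ x, τ x = absoluteGaloisGroup.toAlgEquiv ℚ σ x := fun _ ↦ rfl
  -- `σ ∘ φ = φ`: both agree on the generator `ζ_p` of the power basis of `ℚ(ζ_p)/ℚ`
  let ψ : CyclotomicField p ℚ →ₐ[ℚ] AlgebraicClosure ℚ := (τ.comp φ.toRingHom).toRatAlgHom
  have hψ : ∀ x, ψ x = τ (φ x) := fun _ ↦ rfl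
  have hfix : τ (φ (IsCyclotomicExtension.zeta p ℚ (CyclotomicField p ℚ))) =
      φ (IsCyclotomicExtension.zeta p ℚ (CyclotomicField p ℚ)) := by
    rw [hτ]
    apply hσ _ 1
    rw [pow_one, ← map_pow, hζ.pow_eq_one, map_one]
  have hcomp : ψ = φ := by
    apply (hζ.powerBasis ℚ).algHom_ext
    rw [IsPrimitiveRoot.powerBasis_gen, hψ]
    exact hfix
  have hfixg : absoluteGaloisGroup.toAlgEquiv ℚ σ (φ g) = φ g := by
    rw [← hτ, ← hψ, hcomp]
  -- `geomSqrt p* = ± φ(g)`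
  have hsq : geomSqrt ((-1 : ℚ) ^ (p / 2) * p) ^ 2 = (φ g) ^ 2 := by
    rw [geomSqrt_sq, ← map_pow, hg]
    simp
  rw [absoluteGaloisGroup.smul_def]
  rcases sq_eq_sq_iff_eq_or_eq_neg.mp hsq with h | h
  · rw [h, hfixg]
  · rw [h, map_neg, hfixg]

/-! ### (im) for `E` and for `E^{(p*)}` -/

section PStar

variable (W : WeierstrassCurve ℚ) (p : ℕ) [hp : Fact p.Prime]

/-- **`BigIm E^{(p*)} p ↔ BigIm E p`** (`p` odd, `p* = (−1)^{⌊p/2⌋} p`): the twisting isomorphism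
`E^{(p*)}(ℚ̄) ≃+ E(ℚ̄)` (tree `exists_addEquiv_geomPoints_quadraticTwist`, Silverman *AEC* X.5
Cor. 5.4) commutes with every `σ ∈ Γ_ℚ` fixing `√p*`, in particular (`smul_geomSqrt_pStar`) with
every `σ ∈ G_{ℚ(μ_{p^∞})}`; so the (im) witness `σ` of one curve is an (im) witness of the other
(`bigIm_of_addEquiv`). As Galois modules, `T_pE^{(p*)} = T_pE ⊗ χ_{p*}` and `χ_{p*}` is trivial on
`G_{ℚ(μ_p)}`. [cite: BurungaleCastellaSkinner2025, p. 2, hypothesis (im)]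
[cite: SilvermanAEC2009, X.5 Cor. 5.4] -/
theorem bigIm_quadraticTwist_pStar_iff (hp2 : p ≠ 2) :
    BigIm (W.quadraticTwist ((-1 : ℚ) ^ (p / 2) * p)) p ↔ BigIm W p := by
  have hd : ((-1 : ℚ) ^ (p / 2) * p) ≠ 0 :=
    mul_ne_zero (pow_ne_zero _ (by norm_num)) (by exact_mod_cast hp.out.ne_zero)
  haveI : NeZero (2 : ℚ) := ⟨two_ne_zero⟩
  obtain ⟨f, hf⟩ := W.exists_addEquiv_geomPoints_quadraticTwist hd
  have hfσ : ∀ σ : absoluteGaloisGroup ℚ,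
      (∀ ζ : AlgebraicClosure ℚ, ∀ n : ℕ, ζ ^ p ^ n = 1 →
        absoluteGaloisGroup.toAlgEquiv ℚ σ ζ = ζ) →
      ∀ P, f (σ • P) = σ • f P :=
    fun σ hσ P ↦ hf σ (smul_geomSqrt_pStar p hp2 σ hσ) P
  constructor
  · exact bigIm_of_addEquiv p f hfσ
  · intro h
    refine bigIm_of_addEquiv p f.symm (fun σ hσ P ↦ ?_) h
    apply f.injective
    rw [AddEquiv.apply_symm_apply, hfσ σ hσ, AddEquiv.apply_symm_apply]

/-- **(im) for any `ℚ`-model of the twist by `p*`**: if `C • E^{(p*)} = Wd` over `ℚ` (e.g. `Wd` a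
globally minimal model of `E^{(p*)}`), then `BigIm Wd p ↔ BigIm E p` (`p` odd).
[cite: BurungaleCastellaSkinner2025, p. 2, hypothesis (im)] -/
theorem bigIm_iff_of_model_twist_pStar (hp2 : p ≠ 2) {Wd : WeierstrassCurve ℚ}
    (hWd : ∃ C : VariableChange ℚ, C • W.quadraticTwist ((-1 : ℚ) ^ (p / 2) * p) = Wd) :
    BigIm Wd p ↔ BigIm W p := by
  obtain ⟨C, rfl⟩ := hWd
  rw [bigIm_smul_iff, bigIm_quadraticTwist_pStar_iff W p hp2]

end PStar

end Summit.BirchSwinnertonDyer.Rank1Residual.Additive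

end
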